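import Mathlib
import Summits.ValiantsHypothesis.ValiantsHypothesis.Theorems.ChowBorderDepth3ChowBorderBoundFanInTwoRung

/-!
# Crux `Depth3Thesis` (stmt-ValiantsHypothesis-5934), line `registered` — stub `stub_binomialGrowth`

**Claim settled** (TRUE, pure `ℕ` arithmetic): the arithmetic of the flattening regime `D ≤ 2n` of the
birth line of `Depth3Thesis`. For every `c` there is an `n₀` such that for all `n ≥ n₀` and all
`D ≤ 2n`,
`(n+2)^(c⌊√n⌋+c) · binom(D,⌊n/2⌋) < binom(n,⌊n/2⌋)²`.

Proof (no logarithms, no casts; `j := ⌊n/2⌋`, `s := ⌊√n⌋`).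
* Binomial estimates: `binom(D,j) ≤ binom(2n,j)`; `binom(2n,j) · 3^(2n-j) ≤ (1+3)^(2n) = 16^n` (one
  term of a binomial expansion) while `3^(2(2n-j)) ≥ 27^n` (as `2j ≤ n`); and the middle binomial
  coefficient satisfies `2^n ≤ (n+1) · binom(n,j)`.
* With `A := (n+2)^(cs+c) (n+1)²` these reduce the claim to `A² · 16^n < 27^n`, i.e. to the growth
  estimate `(n+2)^(2c·s+2c+4) · 16^n < 27^n`.
* Growth lemma (`growth_pow_lt_pow`, stated for all `p < q`): `(n+2)^(a s+b) · p^n < q^n` eventually.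
  Via `(p+1)^n ≥ p^(n-t) binom(n,t)` and the division-free bound `(n+1-t)^t ≤ t^t binom(n,t)` at
  `t = 3u`, `u = a s + b + 1`, it reduces to the cubic inequality `(n+2)(3pu)³ < (n+1-3u)³`, which is
  elementary bookkeeping once `s ≥ 216 p³ (a+b+1)³ + 6 (a+b+1)`.

Unconditional; Mathlib (`add_pow`, `Nat.choose_le_choose`, `Nat.pow_sub_le_descFactorial`,
`Nat.descFactorial_eq_factorial_mul_choose`, `Nat.factorial_le_pow`, `Nat.le_sqrt`, `Nat.sqrt_le`) plus the
landed tree lemma `ChowBorderBound.FanInTwoRung.two_pow_le_succ_mul_choose_middle`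
(`2^n ≤ (n+1) · binom(n,⌊n/2⌋)`, from `Nat.sum_range_choose` and `Nat.choose_le_middle`).
-/

-- layout Summits/ValiantsHypothesis/ValiantsHypothesis forces the duplicated namespace component
set_option linter.dupNamespace false

namespace Summit.ValiantsHypothesis.ValiantsHypothesis.Theorems.SummationBitsDepth3Thesis

open Finset

/-! ### Binomial-coefficient estimates -/

/-- One term of the binomial expansion of `(p + 1)^n`: `p^(n-t) · binom(n,t) ≤ (p+1)^n` (`t ≤ n`). -/
theorem pow_mul_choose_le_succ_pow (p n t : ℕ) (ht : t ≤ n) :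
    p ^ (n - t) * n.choose t ≤ (p + 1) ^ n := by
  have hmem : t ∈ range (n + 1) := mem_range.2 (Nat.lt_succ_of_le ht)
  rw [add_comm, add_pow]
  calc p ^ (n - t) * n.choose t = 1 ^ t * p ^ (n - t) * n.choose t := by rw [one_pow, one_mul]
    _ ≤ ∑ m ∈ range (n + 1), 1 ^ m * p ^ (n - m) * n.choose m :=
        single_le_sum (f := fun m => 1 ^ m * p ^ (n - m) * n.choose m)
          (fun _ _ => Nat.zero_le _) hmem

/-- Division-free lower bound for a binomial coefficient: `(n+1-t)^t ≤ t^t · binom(n,t)`. -/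
theorem pow_sub_le_pow_mul_choose (n t : ℕ) : (n + 1 - t) ^ t ≤ t ^ t * n.choose t :=
  calc (n + 1 - t) ^ t ≤ n.descFactorial t := Nat.pow_sub_le_descFactorial n t
    _ = t.factorial * n.choose t := Nat.descFactorial_eq_factorial_mul_choose n t
    _ ≤ t ^ t * n.choose t := Nat.mul_le_mul_right _ (Nat.factorial_le_pow t)

/-- `16^n = 4^n · 4^n`. -/
theorem sixteen_pow (n : ℕ) : (16 : ℕ) ^ n = 4 ^ n * 4 ^ n :=
  calc (16 : ℕ) ^ n = (4 * 4) ^ n := by norm_num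
    _ = 4 ^ n * 4 ^ n := mul_pow 4 4 n

/-- One term of `(1+3)^(2n)`: `binom(2n,j) · 3^(2n-j) ≤ 16^n` for `j ≤ 2n`. -/
theorem choose_two_mul_mul_three_pow_le (n j : ℕ) (hj : j ≤ 2 * n) :
    (2 * n).choose j * 3 ^ (2 * n - j) ≤ 16 ^ n :=
  calc (2 * n).choose j * 3 ^ (2 * n - j) = 3 ^ (2 * n - j) * (2 * n).choose j := mul_comm _ _
    _ ≤ (3 + 1) ^ (2 * n) := pow_mul_choose_le_succ_pow 3 (2 * n) j hj
    _ = ((3 + 1) ^ 2) ^ n := pow_mul _ 2 n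
    _ = 16 ^ n := by norm_num

/-! ### The growth lemma: `(n+2)^(a⌊√n⌋+b) · p^n < q^n` eventually, for `p < q` -/

/-- The cubic inequality behind the growth lemma, by elementary bookkeeping: if `u ≤ M s`, `s² ≤ n`,
`6M ≤ s` and `216 p³ M³ ≤ s`, then `(n+2) · (3pu)³ < (n+1-3u)³`. -/
theorem cubic_of_bounds (p n s u M : ℕ) (huM : u ≤ M * s) (hsn : s * s ≤ n) (h6 : 6 * M ≤ s)
    (hK : 216 * p ^ 3 * M ^ 3 ≤ s) :
    (n + 2) * (p * (3 * u)) ^ 3 < (n + 1 - 3 * u) ^ 3 := by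
  -- `6u ≤ n`, hence `n + 2 ≤ 2 (n + 1 - 3u)`
  have h6u : 6 * u ≤ n :=
    calc 6 * u ≤ 6 * (M * s) := Nat.mul_le_mul_left 6 huM
      _ = 6 * M * s := (mul_assoc _ _ _).symm
      _ ≤ s * s := Nat.mul_le_mul_right s h6
      _ ≤ n := hsn
  obtain ⟨w, hw⟩ : ∃ w : ℕ, w = n + 1 - 3 * u := ⟨_, rfl⟩
  rw [← hw]
  have hw2 : n + 2 ≤ 2 * w := by omega
  -- `8 (3pu)³ < (n+2)²`
  have hkey : 8 * (p * (3 * u)) ^ 3 < (n + 2) ^ 2 :=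
    calc 8 * (p * (3 * u)) ^ 3 = 216 * p ^ 3 * u ^ 3 := by ring
      _ ≤ 216 * p ^ 3 * (M * s) ^ 3 := Nat.mul_le_mul_left _ (Nat.pow_le_pow_left huM 3)
      _ = 216 * p ^ 3 * M ^ 3 * s ^ 3 := by ring
      _ ≤ s * s ^ 3 := Nat.mul_le_mul_right _ hK
      _ = (s * s) ^ 2 := by ring
      _ ≤ n ^ 2 := Nat.pow_le_pow_left hsn 2
      _ < (n + 2) ^ 2 := Nat.pow_lt_pow_left (by omega) (by norm_num)
  have h8 : 8 * ((n + 2) * (p * (3 * u)) ^ 3) < 8 * w ^ 3 :=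
    calc 8 * ((n + 2) * (p * (3 * u)) ^ 3) = (n + 2) * (8 * (p * (3 * u)) ^ 3) := by ring
      _ < (n + 2) * (n + 2) ^ 2 := Nat.mul_lt_mul_of_pos_left hkey (by omega)
      _ = (n + 2) ^ 3 := by ring
      _ ≤ (2 * w) ^ 3 := Nat.pow_le_pow_left hw2 3
      _ = 8 * w ^ 3 := by ring
  exact Nat.lt_of_mul_lt_mul_left h8

/-- Key reduction of the growth lemma to the cubic inequality: if `0 < p`, `1 ≤ u` and
`(n+2) · (3pu)³ < (n+1-3u)³`, then `(n+2)^u · p^n < (p+1)^n`. Indeed, with `t = 3u`: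
`(n+2)^u (pt)^t = ((n+2)(pt)³)^u < ((n+1-t)³)^u = (n+1-t)^t ≤ t^t binom(n,t)`, so
`(n+2)^u p^t < binom(n,t)` and `(n+2)^u p^n < p^(n-t) binom(n,t) ≤ (p+1)^n`. -/
theorem pow_mul_pow_lt_succ_pow_of_cubic (p n u : ℕ) (hp : 0 < p) (hu : 1 ≤ u)
    (hcubic : (n + 2) * (p * (3 * u)) ^ 3 < (n + 1 - 3 * u) ^ 3) :
    (n + 2) ^ u * p ^ n < (p + 1) ^ n := by
  obtain ⟨t, ht⟩ : ∃ t : ℕ, t = 3 * u := ⟨_, rfl⟩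
  rw [← ht] at hcubic
  -- `t ≤ n`: the right-hand side of the cubic inequality is positive
  have htn : t ≤ n := by
    by_contra h
    rw [show n + 1 - t = 0 by omega] at hcubic
    simp at hcubic
  -- `(n+2)^u (pt)^t < (n+1-t)^t`
  have h1 : (n + 2) ^ u * (p * t) ^ t < (n + 1 - t) ^ t := by
    have hu0 : u ≠ 0 := by omega
    calc (n + 2) ^ u * (p * t) ^ t = (n + 2) ^ u * ((p * t) ^ 3) ^ u := by rw [← pow_mul, ← ht]
      _ = ((n + 2) * (p * t) ^ 3) ^ u := (mul_pow _ _ _).symm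
      _ < ((n + 1 - t) ^ 3) ^ u := Nat.pow_lt_pow_left hcubic hu0
      _ = (n + 1 - t) ^ t := by rw [← pow_mul, ← ht]
  -- `(n+2)^u p^t < binom(n,t)`
  have h2 : (n + 2) ^ u * p ^ t < n.choose t := by
    have h3 : (n + 2) ^ u * p ^ t * t ^ t < n.choose t * t ^ t :=
      calc (n + 2) ^ u * p ^ t * t ^ t = (n + 2) ^ u * (p * t) ^ t := by rw [mul_pow, mul_assoc]
        _ < (n + 1 - t) ^ t := h1
        _ ≤ t ^ t * n.choose t := pow_sub_le_pow_mul_choose n t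
        _ = n.choose t * t ^ t := mul_comm _ _
    exact Nat.lt_of_mul_lt_mul_right h3
  -- multiply by `p^(n-t)` and use one term of the binomial expansion of `(p+1)^n`
  calc (n + 2) ^ u * p ^ n = (n + 2) ^ u * p ^ t * p ^ (n - t) := by
        rw [mul_assoc, ← pow_add, Nat.add_sub_of_le htn]
    _ < n.choose t * p ^ (n - t) := Nat.mul_lt_mul_of_pos_right h2 (Nat.pow_pos hp)
    _ = p ^ (n - t) * n.choose t := mul_comm _ _
    _ ≤ (p + 1) ^ n := pow_mul_choose_le_succ_pow p n t htn

/-- Growth lemma, successor form: for `0 < p`, `(n+2)^(a⌊√n⌋+b) · p^n < (p+1)^n` for all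
`n ≥ (216 p³ M³ + 6M)²`, `M = a + b + 1`. -/
theorem growth_lt_succ_pow (p a b : ℕ) (hp : 0 < p) :
    ∃ n₀ : ℕ, ∀ n : ℕ, n₀ ≤ n → (n + 2) ^ (a * Nat.sqrt n + b) * p ^ n < (p + 1) ^ n := by
  obtain ⟨M, hM⟩ : ∃ M : ℕ, M = a + b + 1 := ⟨_, rfl⟩
  obtain ⟨C, hC⟩ : ∃ C : ℕ, C = 216 * p ^ 3 * M ^ 3 := ⟨_, rfl⟩
  refine ⟨(C + 6 * M) * (C + 6 * M), fun n hn => ?_⟩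
  have hKs : C + 6 * M ≤ Nat.sqrt n := Nat.le_sqrt.2 hn
  have hsn : Nat.sqrt n * Nat.sqrt n ≤ n := Nat.sqrt_le n
  generalize Nat.sqrt n = s at hKs hsn ⊢
  have hs1 : 1 ≤ s := by omega
  -- the exponent actually used: `u = a s + (b + 1) ≥ 1`, `u ≤ M s`
  have huM : a * s + (b + 1) ≤ M * s := by
    rw [hM]
    calc a * s + (b + 1) ≤ a * s + (b + 1) * s :=
          Nat.add_le_add_left (Nat.le_mul_of_pos_right _ hs1) _
      _ = (a + b + 1) * s := by ring
  have hcubic := cubic_of_bounds p n s (a * s + (b + 1)) M huM hsn (by omega) (by rw [← hC]; omega)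
  have hmain := pow_mul_pow_lt_succ_pow_of_cubic p n (a * s + (b + 1)) hp (by omega) hcubic
  calc (n + 2) ^ (a * s + b) * p ^ n ≤ (n + 2) ^ (a * s + (b + 1)) * p ^ n :=
        Nat.mul_le_mul_right _ (Nat.pow_le_pow_right (by omega) (by omega))
    _ < (p + 1) ^ n := hmain

/-- **Growth lemma.** For `p < q` and all `a b`: `(n+2)^(a⌊√n⌋+b) · p^n < q^n` for all large `n`
(a quasi-polynomial factor `2^(O(√n log n))` is swallowed by any exponential gap). -/
theorem growth_pow_lt_pow (p q a b : ℕ) (hpq : p < q) :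
    ∃ n₀ : ℕ, ∀ n : ℕ, n₀ ≤ n → (n + 2) ^ (a * Nat.sqrt n + b) * p ^ n < q ^ n := by
  rcases Nat.eq_zero_or_pos p with rfl | hp
  · refine ⟨1, fun n hn => ?_⟩
    rw [zero_pow (by omega : n ≠ 0), mul_zero]
    exact Nat.pow_pos (by omega)
  · obtain ⟨n₀, h⟩ := growth_lt_succ_pow p a b hp
    exact ⟨n₀, fun n hn => lt_of_lt_of_le (h n hn) (Nat.pow_le_pow_left (Nat.succ_le_of_lt hpq) n)⟩

/-- The instance used by the stub: `(n+2)^(a⌊√n⌋+b) · 16^n < 27^n` for all large `n`. -/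
theorem growth_sixteen_lt_twentyseven (a b : ℕ) :
    ∃ n₀ : ℕ, ∀ n : ℕ, n₀ ≤ n → (n + 2) ^ (a * Nat.sqrt n + b) * 16 ^ n < 27 ^ n :=
  growth_pow_lt_pow 16 27 a b (by norm_num)

/-! ### The stub -/

/-- The stub at ONE `n`, from the growth estimate with exponents `2c`, `2c+4` at that `n`:
if `(n+2)^(2c⌊√n⌋+2c+4) · 16^n < 27^n` and `D ≤ 2n` then
`(n+2)^(c⌊√n⌋+c) · binom(D,⌊n/2⌋) < binom(n,⌊n/2⌋)²`. -/
theorem binomialGrowth_at {n c D : ℕ} (hD : D ≤ 2 * n)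
    (hgrowth : (n + 2) ^ (2 * c * Nat.sqrt n + (2 * c + 4)) * 16 ^ n < 27 ^ n) :
    (n + 2) ^ (c * Nat.sqrt n + c) * D.choose (n / 2) < (n.choose (n / 2)) ^ 2 := by
  have hmid : 2 ^ n ≤ (n + 1) * n.choose (n / 2) :=
    ChowBorderBound.FanInTwoRung.two_pow_le_succ_mul_choose_middle n
  have hj2 : 2 * (n / 2) ≤ n := Nat.mul_div_le n 2
  generalize Nat.sqrt n = s at hgrowth ⊢
  generalize n / 2 = j at hmid hj2 ⊢
  have hjn : j ≤ 2 * n := by omega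
  obtain ⟨A, hA⟩ : ∃ A : ℕ, A = (n + 2) ^ (c * s + c) * (n + 1) ^ 2 := ⟨_, rfl⟩
  -- (i) `A² · 16^n < 27^n`
  have hA2 : A ≤ (n + 2) ^ (c * s + c + 2) := by
    rw [hA, pow_add (n + 2) (c * s + c) 2]
    exact Nat.mul_le_mul_left _ (Nat.pow_le_pow_left (by omega) 2)
  have h1 : A ^ 2 * 16 ^ n < 27 ^ n :=
    calc A ^ 2 * 16 ^ n ≤ ((n + 2) ^ (c * s + c + 2)) ^ 2 * 16 ^ n :=
          Nat.mul_le_mul_right _ (Nat.pow_le_pow_left hA2 2)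
      _ = (n + 2) ^ (2 * c * s + (2 * c + 4)) * 16 ^ n := by
          rw [← pow_mul, show (c * s + c + 2) * 2 = 2 * c * s + (2 * c + 4) by ring]
      _ < 27 ^ n := hgrowth
  -- (ii) `27^n ≤ (3^(2n-j))²`, hence `A · 4^n < 3^(2n-j)`
  have h2 : A * 4 ^ n < 3 ^ (2 * n - j) := by
    have hsq : (A * 4 ^ n) ^ 2 < (3 ^ (2 * n - j)) ^ 2 :=
      calc (A * 4 ^ n) ^ 2 = A ^ 2 * (4 ^ 2) ^ n := by rw [mul_pow, pow_right_comm 4 n 2]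
        _ = A ^ 2 * 16 ^ n := by norm_num
        _ < 27 ^ n := h1
        _ = (3 ^ 3) ^ n := by norm_num
        _ = 3 ^ (3 * n) := (pow_mul 3 3 n).symm
        _ ≤ 3 ^ ((2 * n - j) * 2) := Nat.pow_le_pow_right (by norm_num) (by omega)
        _ = (3 ^ (2 * n - j)) ^ 2 := pow_mul _ _ _
    exact (Nat.pow_lt_pow_iff_left (by norm_num)).1 hsq
  -- (iii) `A · binom(2n,j) < 4^n`
  have h3 : A * (2 * n).choose j < 4 ^ n := by
    have h4 : A * (2 * n).choose j * 3 ^ (2 * n - j) < 4 ^ n * 3 ^ (2 * n - j) :=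
      calc A * (2 * n).choose j * 3 ^ (2 * n - j)
          = A * ((2 * n).choose j * 3 ^ (2 * n - j)) := mul_assoc _ _ _
        _ ≤ A * 16 ^ n := Nat.mul_le_mul_left _ (choose_two_mul_mul_three_pow_le n j hjn)
        _ = A * 4 ^ n * 4 ^ n := by rw [sixteen_pow, mul_assoc]
        _ < 3 ^ (2 * n - j) * 4 ^ n := Nat.mul_lt_mul_of_pos_right h2 (by positivity)
        _ = 4 ^ n * 3 ^ (2 * n - j) := mul_comm _ _
    exact Nat.lt_of_mul_lt_mul_right h4
  -- (iv) `4^n ≤ (n+1)² · binom(n,j)²`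
  have h4 : 4 ^ n ≤ (n + 1) ^ 2 * (n.choose j) ^ 2 :=
    calc 4 ^ n = (2 ^ 2) ^ n := by norm_num
      _ = (2 ^ n) ^ 2 := pow_right_comm 2 2 n
      _ ≤ ((n + 1) * n.choose j) ^ 2 := Nat.pow_le_pow_left hmid 2
      _ = (n + 1) ^ 2 * (n.choose j) ^ 2 := mul_pow _ _ _
  -- (v) assemble and cancel `(n+1)²`
  have h5 : (n + 2) ^ (c * s + c) * D.choose j * (n + 1) ^ 2 < (n.choose j) ^ 2 * (n + 1) ^ 2 :=
    calc (n + 2) ^ (c * s + c) * D.choose j * (n + 1) ^ 2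
        ≤ (n + 2) ^ (c * s + c) * (2 * n).choose j * (n + 1) ^ 2 :=
          Nat.mul_le_mul_right _ (Nat.mul_le_mul_left _ (Nat.choose_le_choose j hD))
      _ = A * (2 * n).choose j := by rw [hA]; ring
      _ < 4 ^ n := h3
      _ ≤ (n + 1) ^ 2 * (n.choose j) ^ 2 := h4
      _ = (n.choose j) ^ 2 * (n + 1) ^ 2 := mul_comm _ _
  exact Nat.lt_of_mul_lt_mul_right h5

/-- **Registered stub `stub_binomialGrowth`** of the birth line of crux `Depth3Thesis`
(stmt-ValiantsHypothesis-5934): the arithmetic of the flattening regime `D ≤ 2n`. For every `c`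
there is `n₀` such that `(n+2)^(c⌊√n⌋+c) · binom(D,⌊n/2⌋) < binom(n,⌊n/2⌋)²` for all `n ≥ n₀` and
all `D ≤ 2n`. -/
theorem stub_binomialGrowth :
    ∀ c : ℕ, ∃ n₀ : ℕ, ∀ n D : ℕ, n₀ ≤ n → D ≤ 2 * n →
      (n + 2) ^ (c * Nat.sqrt n + c) * D.choose (n / 2) < (n.choose (n / 2)) ^ 2 := by
  intro c
  obtain ⟨n₀, h⟩ := growth_sixteen_lt_twentyseven (2 * c) (2 * c + 4)
  exact ⟨n₀, fun n D hn hD => binomialGrowth_at hD (h n hn)⟩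

end Summit.ValiantsHypothesis.ValiantsHypothesis.Theorems.SummationBitsDepth3Thesis
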